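import Literature.Topology.PlanarFoliations.Transversals
import HarnessLib

/-!
# Order intervals of open leaves as Jordan arcs

Topic: Topology / PlanarFoliations, sequel to `LeafOrder.lean`, `Transversals.lean` (the leaf order of an open leaf of
a bi-oriented planar foliation, read in the nested line charts; order intervals `leafIcc`). For
`a < a'` in an open leaf, **the order interval `[a, a']` is an injective path of the ambient space
from `a` to `a'`, continuous in the leaf topology, with image exactly `[a, a']`**
(`exists_leafIccPath`): the inverse of a line chart containing both points, composed with the
affine map onto `[c a, c a']`. These are the links of the walks along separatrix graphs
(`WalkFence.lean`), and the pieces of the Jordan loops traced by simple closed walks.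

* `leafIccPath` (**definition**) with `leafIccPath_apply_mem`, `injective_leafIccPath`,
  `continuous_toLeafSpace_leafIccPath`, `range_leafIccPath` (**proved**);
* `exists_leafIccPath` (**proved**, the packaged statement).

All statements are [folklore].
-/

noncomputable section

open Set Filter Function unitInterval
open _root_.Topology
open Literature.Topology.FourManifolds Literature.Topology.FourManifolds.Foliation
  Literature.Topology.FourManifolds.OneManifold

namespace Literature.Topology.PlanarFoliations

variable {X : Type*} [TopologicalSpace X] [T2Space X] [SecondCountableTopology X] {F : Foliation ℝ X} {x : X}
variable [NoncompactSpace (F.Leaf x)] {hbi : IsBiOriented F}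

/-- The affine parameter from `c a` to `c a'`. [folklore] -/
private def affI (s s' : ℝ) (t : I) : ℝ := s + (t : ℝ) * (s' - s)

/-- The affine parameter is continuous. [folklore] -/
private theorem continuous_affI (s s' : ℝ) : Continuous (affI s s') := by unfold affI; fun_prop

/-- The affine parameter lands in `[s, s']`. [folklore] -/
private theorem affI_mem {s s' : ℝ} (h : s ≤ s') (t : I) : affI s s' t ∈ Icc s s' := by
  unfold affI; constructor <;> nlinarith [t.2.1, t.2.2]

/-- The affine parameter is injective for `s < s'`. [folklore] -/
private theorem injective_affI {s s' : ℝ} (h : s < s') : Injective (affI s s') := fun t t' htt' ↦ by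
  unfold affI at htt'
  have : ((t : ℝ) - t') * (s' - s) = 0 := by linarith
  rcases mul_eq_zero.1 this with h0 | h0
  · exact Subtype.ext (by linarith)
  · linarith

variable (hbi) in
/-- **The order interval `[a, a']` as a path of leaf points**, in the line chart `n`. [folklore] -/
def leafIccPath (n : ℕ) (a a' : F.Leaf x) (t : I) : F.Leaf x :=
  (lineCharts hbi x n).symm (affI (lineCharts hbi x n a) (lineCharts hbi x n a') t)

variable {n : ℕ} {a a' : F.Leaf x}

/-- The path is continuous (in the leaf topology). [folklore] -/
theorem continuous_leafIccPath : Continuous (leafIccPath hbi n a a') :=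
  (arc_continuous_symm (lineCharts_target hbi n)).comp (continuous_affI _ _)

/-- The path starts at `a`. [folklore] -/
theorem leafIccPath_zero (ha : a ∈ (lineCharts hbi x n).source) : leafIccPath hbi n a a' 0 = a := by
  simp only [leafIccPath, affI, Icc.coe_zero, zero_mul, add_zero]
  exact (lineCharts hbi x n).left_inv ha

/-- The path ends at `a'`. [folklore] -/
theorem leafIccPath_one (ha' : a' ∈ (lineCharts hbi x n).source) : leafIccPath hbi n a a' 1 = a' := by
  simp only [leafIccPath, affI, Icc.coe_one, one_mul, add_sub_cancel]
  exact (lineCharts hbi x n).left_inv ha'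

/-- **The path is injective** when `a < a'`. [folklore] -/
theorem injective_leafIccPath (ha : a ∈ (lineCharts hbi x n).source) (ha' : a' ∈ (lineCharts hbi x n).source)
    (h : leafLT hbi a a') : Injective (leafIccPath hbi n a a') := by
  intro t t' htt'
  have hlt : lineCharts hbi x n a < lineCharts hbi x n a' := (leafLT_iff ha ha').1 h
  have h' := congrArg (lineCharts hbi x n) htt'
  simp only [leafIccPath, arc_apply_symm (lineCharts_target hbi n)] at h'
  exact injective_affI hlt h'

/-- **The range of the path is the order interval.** [folklore] -/
theorem range_leafIccPath (ha : a ∈ (lineCharts hbi x n).source) (ha' : a' ∈ (lineCharts hbi x n).source)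
    (h : ¬ leafLT hbi a' a) : range (leafIccPath hbi n a a') = leafIcc hbi a a' := by
  have hle : lineCharts hbi x n a ≤ lineCharts hbi x n a' := by
    rcases not_leafLT_iff.1 h with h' | h'
    · exact ((leafLT_iff ha ha').1 h').le
    · rw [h']
  rw [leafIcc_eq_image ha ha']
  ext r
  constructor
  · rintro ⟨t, rfl⟩
    exact ⟨_, affI_mem hle t, rfl⟩
  · rintro ⟨s, hs, rfl⟩
    -- the parameter of `s`
    rcases hle.eq_or_lt with heq | hlt
    · refine ⟨0, ?_⟩
      have hs' : s = lineCharts hbi x n a := le_antisymm (heq ▸ hs.2) hs.1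
      simp only [leafIccPath, affI, Icc.coe_zero, zero_mul, add_zero, hs']
    · set d := lineCharts hbi x n a' - lineCharts hbi x n a with hd
      have hd0 : 0 < d := by rw [hd]; linarith
      refine ⟨⟨(s - lineCharts hbi x n a) / d, div_nonneg (by linarith [hs.1]) hd0.le,
        (div_le_one hd0).2 (by rw [hd]; linarith [hs.2])⟩, ?_⟩
      simp only [leafIccPath, affI]
      congr 1
      rw [hd]; field_simp; ring

/-- The points of the path lie in the order interval. [folklore] -/
theorem leafIccPath_apply_mem (ha : a ∈ (lineCharts hbi x n).source) (ha' : a' ∈ (lineCharts hbi x n).source)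
    (h : ¬ leafLT hbi a' a) (t : I) : leafIccPath hbi n a a' t ∈ leafIcc hbi a a' := by
  rw [← range_leafIccPath ha ha' h]; exact ⟨t, rfl⟩

/-- **The order interval `[a, a']` of an open leaf is a Jordan arc**: an injective path of `X`
from `a` to `a'`, continuous in the leaf topology, whose points are exactly those of `[a, a']`.
[folklore] -/
theorem exists_leafIccPath (h : leafLT hbi a a') :
    ∃ ℓ : Path (Leaf.pt a) (Leaf.pt a'), Continuous (toLeafSpace ∘ ℓ : I → F.LeafSpace) ∧ Injective ℓ ∧
      ∀ y, y ∈ range ℓ ↔ ∃ r ∈ leafIcc hbi a a', Leaf.pt r = y := by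
  obtain ⟨n, ha, ha'⟩ := exists_mem_lineCharts_source₂ (hbi := hbi) a a'
  set γ := leafIccPath hbi n a a' with hγ
  have hγc : Continuous γ := continuous_leafIccPath
  have hptc : Continuous fun t ↦ Leaf.pt (γ t) := (Leaf.continuous_coe F x).comp hγc
  refine ⟨⟨⟨fun t ↦ Leaf.pt (γ t), hptc⟩, ?_, ?_⟩, ?_, ?_, fun y ↦ ?_⟩
  · show Leaf.pt (γ 0) = Leaf.pt a; rw [hγ, leafIccPath_zero ha]
  · show Leaf.pt (γ 1) = Leaf.pt a'; rw [hγ, leafIccPath_one ha']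
  · show Continuous fun t ↦ toLeafSpace (Leaf.pt (γ t))
    have : (fun t ↦ toLeafSpace (Leaf.pt (γ t))) = fun t ↦ ((γ t : F.Leaf x) : F.LeafSpace) := by
      funext t; exact toLeafSpace_ofLeafSpace _
    rw [this]
    exact continuous_subtype_val.comp hγc
  · intro t t' htt'
    exact injective_leafIccPath ha ha' h (Leaf.injective_coe F x htt')
  · constructor
    · rintro ⟨t, rfl⟩
      exact ⟨γ t, leafIccPath_apply_mem ha ha' (leafLT_asymm h) t, rfl⟩
    · rintro ⟨r, hr, rfl⟩
      rw [← range_leafIccPath ha ha' (leafLT_asymm h)] at hr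
      obtain ⟨t, rfl⟩ := hr
      exact ⟨t, rfl⟩

end Literature.Topology.PlanarFoliations
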